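import Mathlib.LinearAlgebra.Dual.Lemmas
import Mathlib.LinearAlgebra.Determinant
import Mathlib.LinearAlgebra.Trace
import Mathlib.LinearAlgebra.Charpoly.ToMatrix
import Mathlib.LinearAlgebra.Matrix.Dual
import Mathlib.RingTheory.TensorProduct.Basic
import Mathlib.Algebra.Algebra.Rat
import Literature.AlgebraicGeometry.Motives.AbelianVarietyCotangent
import HarnessLib

/-!
# The Lie algebra `Lie(A) = T_e A` of an abelian variety and the representation of `End⁰(A)` on it

Let `A` be an abelian variety over a field `K`, with cotangent space at the origin
`𝔪_e/𝔪_e²` (`AbelianVariety.Cotangent A`, `Motives/AbelianVarietyCotangent`) and cotangent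
representation `u ↦ u^*` (`AbelianVariety.cotangentMap`). This file provides the DUAL,
covariant side — the vocabulary in which determinant / characteristic-polynomial conditions on
CM abelian varieties are PRINTED («the determinant of the action of `i_μ(x)` on the `E`-vector
space `Lie_E(A_μ)`», [Liu2021] Def. 4.5, l. 1950; «the characteristic polynomial of `i(e)` on
`Lie_S(A)`», [Liu2021] App. C, l. 4688; Shimura, *Abelian varieties with complex multiplication*
§3.2: the representation of `End(A) ⊗ ℚ` on the tangent space / on invariant differentials):

* `AbelianVariety.Lie A` — the **Lie algebra** `Lie(A) = T_e A`, the `K`-dual of `𝔪_e/𝔪_e²`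
  (Görtz–Wedhorn II, Def. 27.17 / Rem. 27.18: `Lie(G) := T_e G = (𝔪_e/𝔪_e²)^*`; for an abelian
  variety the bracket is zero, so only the `K`-vector space is recorded), of dimension `dim A`
  (`finrank_lie`);
* `AbelianVariety.lieMap A u : Lie A →ₗ[K] Lie A` — the tangent map `Lie(u) = T_e(u)`, the transpose
  of `u^*` (Görtz–Wedhorn II, Rem. 27.18 (1)); it is COVARIANT and additive:
  `AbelianVariety.lieMapRingHom A : End A →+* Module.End K (Lie A)` (`Lie(u ∘ v) = Lie(u) ∘ Lie(v)`,
  `Lie(u + v) = Lie(u) + Lie(v)`, `Lie([n]) = n`);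
* `det_lieMap`, `trace_lieMap`, `charpoly_lieMap` — **the determinant (trace, characteristic
  polynomial) of `Lie(u)` equals that of `u^*` on `𝔪_e/𝔪_e²`** (transpose); this is the kernel form of
  the reading «a determinant condition on `Lie_E(A)` may be checked on the cotangent space»;
* for `K` of characteristic `0`: `AbelianVariety.lieAction A : End⁰(A) →ₐ[ℚ] End_K(Lie A)` — **the
  action of the endomorphism ALGEBRA `End⁰(A) = ℚ ⊗ End(A)` on `Lie(A)`** (`q ⊗ u ↦ q · Lie(u)`), i.e.
  the object «the action of `i_μ(x) ∈ End_E(A_μ)_ℚ` on `Lie_E(A_μ)`» of [Liu2021] Def. 4.5, with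
  `lieAction_of`, `lieAction_tmul`, and the normalisation
  `det_lieAction_of_eq_algebraMap_mul_of` / `det_lieAction_eq_iff`:
  for `y = M⁻¹ · (1 ⊗ f)` (every element of `End⁰(A)` has this form,
  `endAlgebra.exists_eq_algebraMap_mul_of`), `det (y | Lie A) = M^{-dim A} · det (f^* | 𝔪_e/𝔪_e²)`, so
  `det (y | Lie A) = c ↔ det (f^*) = M^{dim A} · c` — the printed determinant condition and its
  cleared-denominator form on the cotangent space are EQUIVALENT.

Everything is proved; there are no named facts.

## What is NOT here

* base change `L ⊗_K Lie_K(A) ≃ Lie_L(A_L)` (flat base change of `Ω¹`, Hartshorne II.8.10) —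
  `Motives/AbelianVarietyCotangentBaseChange`;
* the comparison `ℂ ⊗_{E,σ} 𝔪_e/𝔪_e² ≅ H^{1,0}(A_σ(ℂ))` (Lange–Birkenhake §1.1, GAGA) —
  `HodgeTheory/AbelianVarietyCotangentHodge`;
* [Liu2021] Def. 4.5 itself (`Liu2021/Def45AsPrinted`), which states its first bullet in the
  cleared-denominator cotangent form; `det_lieAction_eq_iff` is the bridge to the printed form.

## Design notes

* `Lie A` is an `abbrev` for `Module.Dual K (Cotangent A)`, so it inherits Mathlib's instances
  (`AddCommGroup`, `Module K`, `FiniteDimensional`, and for `char K = 0` the `ℚ`-structure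
  `Module ℚ`, `IsScalarTower ℚ K`, through `DivisionRing.toRatAlgebra`); no instance is declared here.
* `lieAction` is Mathlib's `Algebra.TensorProduct.lift` of `ℚ → End_K(Lie A)` and `lieMapRingHom`
  (the pattern of `endAlgebra.mapRingHom`, `Motives/BaseChangeAlongInverse`, and of `bettiRep`,
  `ComplexMultiplication/EndAlgebraCommSubalgebraDegreeBound`).
* Mathlib searched and used: `Module.Dual`, `LinearMap.dualMap(_apply/_id/_comp_dualMap)`,
  `LinearMap.det_dualMap`, `LinearMap.trace_transpose'`, `LinearMap.toMatrix_transpose`,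
  `Matrix.charpoly_transpose`, `Subspace.dual_finrank_eq`, `LinearMap.det_smul`,
  `Algebra.TensorProduct.lift(_tmul)`, `Module.algebraMap_end_eq_smul_id`. Mathlib has no Lie
  algebra of a group scheme and no tangent space of a scheme at a point.

## References

* [GortzWedhorn2023] U. Görtz, T. Wedhorn, *Algebraic Geometry II* (2023): Def. 27.17, Rem. 27.18
  (1)–(4) (pp. 805–806), Prop. 27.20 (p. 806), proof of Prop. 27.187 (p. 888).
* [Liu2021] Y. Liu, *Fourier–Jacobi cycles and arithmetic relative trace formula* (arXiv:2102.11518),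
  Def. 4.5 (TeX l. 1936–1964, first bullet l. 1950), App. C l. 4688.
* [Shimura1998] G. Shimura, *Abelian Varieties with Complex Multiplication and Modular Functions*
  (1998), §2.8 (`(δλ)ω = ω ∘ λ`), §3.2 (the representation on invariant differentials is the
  transpose of the representation on the tangent space).
* [MumfordAV1970] D. Mumford, *Abelian Varieties* (1970), §19 (the representation of `End⁰(X)` on
  the tangent space) (not held).
-/

universe u

open CategoryTheory AlgebraicGeometry
open scoped TensorProduct

noncomputable section

namespace Literature.AlgebraicGeometry.Motives

namespace AbelianVariety

variable {K : Type u} [Field K] {A : AbelianVariety K}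

/-! ### The Lie algebra `Lie(A) = T_e A = (𝔪_e/𝔪_e²)^*` -/

variable (A) in
/-- **The Lie algebra `Lie(A)` of an abelian variety** `A/K`: the tangent space `T_e A` at the
origin, i.e. the `K`-dual of the cotangent space `𝔪_e/𝔪_e²` (Görtz–Wedhorn II, Def. 27.17 and
Rem. 27.18: `Lie(G) = T_e(G) = (𝔪_e/𝔪_e²)^*`; the Lie bracket of a commutative group scheme is zero,
so only the `K`-vector space is recorded). This is «the `E`-vector space `Lie_E(A_μ)`» of
[Liu2021] Def. 4.5 (l. 1950). An `abbrev` for Mathlib's `Module.Dual K (Cotangent A)`.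
[cite: GortzWedhorn2023, Def. 27.17 and Rem. 27.18 (pp. 805–806)] -/
abbrev Lie : Type u := Module.Dual K (Cotangent A)

variable (A) in
/-- **`dim_K Lie(A) = dim A`** (Görtz–Wedhorn II, Prop. 27.20: `dim Lie(G) = dim G` for smooth `G`;
here from `dim_K 𝔪_e/𝔪_e² = dim A`, `finrank_cotangent`, and `dim V^* = dim V`).
[cite: GortzWedhorn2023, Prop. 27.20 (p. 806)] -/
theorem finrank_lie : Module.finrank K (Lie A) = A.dim := by
  rw [Subspace.dual_finrank_eq]
  exact finrank_cotangent A

/-! ### The tangent map `Lie(u)` of an endomorphism -/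

variable (A) in
/-- **The tangent map `Lie(u) = T_e(u) : Lie(A) → Lie(A)`** of an endomorphism `u : A → A`: the
transpose of the cotangent map `u^*` on `𝔪_e/𝔪_e²` (Görtz–Wedhorn II, Rem. 27.18 (1): `T_e(u)` is
the `K`-dual of the map induced by `u^♯` on `𝔪_e/𝔪_e²`). Mathlib's `LinearMap.dualMap`.
[cite: GortzWedhorn2023, Rem. 27.18 (1) (p. 805)] -/
def lieMap (u : A ⟶ A) : Lie A →ₗ[K] Lie A :=
  (cotangentMap A u).dualMap

/-- Unfolding: `Lie(u)(v) = v ∘ u^*`, i.e. `(Lie(u) v)(t) = v(u^* t)` (Görtz–Wedhorn II,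
Rem. 27.18 (1)). [cite: GortzWedhorn2023, Rem. 27.18 (1) (p. 805)] -/
@[simp]
theorem lieMap_apply (u : A ⟶ A) (v : Lie A) (t : Cotangent A) :
    lieMap A u v t = v (cotangentMap A u t) :=
  rfl

/-- `Lie(u)` is the transpose (`dualMap`) of `u^*`. [cite: GortzWedhorn2023, Rem. 27.18 (1) (p. 805)] -/
theorem lieMap_eq_dualMap (u : A ⟶ A) : lieMap A u = (cotangentMap A u).dualMap := rfl

/-- **`Lie(v ∘ u) = Lie(v) ∘ Lie(u)`**: the tangent map is covariantly functorial
(Görtz–Wedhorn II, Rem. 27.18 (1); transpose of `(v ∘ u)^* = u^* ∘ v^*`, `cotangentMap_comp`).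
[cite: GortzWedhorn2023, Rem. 27.18 (1) (p. 805)] -/
theorem lieMap_comp (u v : A ⟶ A) : lieMap A (u ≫ v) = lieMap A v ∘ₗ lieMap A u := by
  rw [lieMap, cotangentMap_comp, ← LinearMap.dualMap_comp_dualMap]
  rfl

/-- `Lie(𝟙_A) = id` (functoriality, Görtz–Wedhorn II, Rem. 27.18 (1)).
[cite: GortzWedhorn2023, Rem. 27.18 (1) (p. 805)] -/
theorem lieMap_id : lieMap A (𝟙 A) = LinearMap.id := by
  rw [lieMap, cotangentMap_id, LinearMap.dualMap_id]

/-- `Lie(1) = 1` for the unit of the ring `End A`. [cite: GortzWedhorn2023, Rem. 27.18 (1) (p. 805)] -/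
theorem lieMap_one : lieMap A (1 : End A) = 1 := by
  rw [End.one_def, lieMap_id]
  rfl

/-- **`Lie(u v) = Lie(u) Lie(v)`** for the product `u v = v ≫ u` of `End A` and the product
(composition) of `Module.End K (Lie A)`: the tangent representation is a ring HOMOMORPHISM
(Görtz–Wedhorn II, Rem. 27.18 (1)). [cite: GortzWedhorn2023, Rem. 27.18 (1) (p. 805)] -/
theorem lieMap_mul (u v : End A) : lieMap A (u * v) = lieMap A u * lieMap A v := by
  rw [End.mul_def, lieMap_comp]
  rfl

/-- **`Lie(u + v) = Lie(u) + Lie(v)`**: `T_e(m)` is addition (Görtz–Wedhorn II, Rem. 27.18 (3);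
transpose of `cotangentMap_add`). [cite: GortzWedhorn2023, Rem. 27.18 (3) (p. 806)] -/
theorem lieMap_add (u v : A ⟶ A) : lieMap A (u + v) = lieMap A u + lieMap A v := by
  apply LinearMap.ext
  intro w
  apply LinearMap.ext
  intro t
  simp only [lieMap_apply, cotangentMap_add, LinearMap.add_apply, map_add]

/-- `Lie(0) = 0`. [cite: GortzWedhorn2023, Rem. 27.18 (3) (p. 806)] -/
theorem lieMap_zero : lieMap A (0 : A ⟶ A) = 0 := by
  apply LinearMap.ext
  intro w
  apply LinearMap.ext
  intro t
  simp only [lieMap_apply, cotangentMap_zero, LinearMap.zero_apply, map_zero]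

variable (A) in
/-- **The tangent representation `End(A) → End_K(Lie A)`, `u ↦ Lie(u)`**, a ring homomorphism
(Görtz–Wedhorn II, Rem. 27.18 (1), (3); Mumford §19; Shimura §3.2).
[cite: GortzWedhorn2023, Rem. 27.18 (1) and (3) (pp. 805–806)] -/
def lieMapRingHom : End A →+* Module.End K (Lie A) where
  toFun u := lieMap A u
  map_one' := lieMap_one
  map_mul' := lieMap_mul
  map_zero' := lieMap_zero
  map_add' := lieMap_add

/-- Unfolding of `lieMapRingHom`. [cite: GortzWedhorn2023, Rem. 27.18 (1) and (3) (pp. 805–806)] -/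
@[simp]
theorem lieMapRingHom_apply (u : End A) : lieMapRingHom A u = lieMap A u := rfl

/-- `Lie(-u) = -Lie(u)`. [cite: GortzWedhorn2023, Rem. 27.18 (3) (p. 806)] -/
theorem lieMap_neg (u : A ⟶ A) : lieMap A (-u) = -lieMap A u :=
  map_neg (lieMapRingHom A) u

/-- `Lie(u - v) = Lie(u) - Lie(v)`. [cite: GortzWedhorn2023, Rem. 27.18 (3) (p. 806)] -/
theorem lieMap_sub (u v : A ⟶ A) : lieMap A (u - v) = lieMap A u - lieMap A v :=
  map_sub (lieMapRingHom A) u v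

/-- `Lie(n u) = n Lie(u)` for `n ∈ ℤ`. [cite: GortzWedhorn2023, Rem. 27.18 (3) (p. 806)] -/
theorem lieMap_zsmul (n : ℤ) (u : A ⟶ A) : lieMap A (n • u) = n • lieMap A u :=
  map_zsmul (lieMapRingHom A) n u

/-- `Lie(n u) = n Lie(u)` for `n ∈ ℕ`. [cite: GortzWedhorn2023, Rem. 27.18 (3) (p. 806)] -/
theorem lieMap_nsmul (n : ℕ) (u : A ⟶ A) : lieMap A (n • u) = n • lieMap A u :=
  map_nsmul (lieMapRingHom A) n u

/-- **`Lie([n]_A) = n`** (Görtz–Wedhorn II, proof of Prop. 27.187: "`Lie([n])` is simply the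
multiplication by `n`"; transpose of `cotangentMap_zsmul_id_eq_smul`).
[cite: GortzWedhorn2023, proof of Prop. 27.187 (p. 888)] -/
theorem lieMap_zsmul_id_eq_smul (n : ℤ) :
    lieMap A (n • 𝟙 A) = (n : K) • (LinearMap.id : Lie A →ₗ[K] Lie A) := by
  apply LinearMap.ext
  intro w
  apply LinearMap.ext
  intro t
  simp only [lieMap_apply, cotangentMap_zsmul_id_eq_smul, LinearMap.smul_apply, LinearMap.id_apply,
    map_smul]

/-! ### Determinant, trace and characteristic polynomial: `Lie(u)` versus `u^*` -/

/-- **`det Lie(u) = det (u^* | 𝔪_e/𝔪_e²)`**: a determinant condition on the Lie algebra may be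
checked on the cotangent space (transpose; Mathlib `LinearMap.det_dualMap`). This is the step
«`S` is the transpose of the representation of `δλ`» of Shimura §3.2 read for determinants.
[cite: Shimura1998, §3.2 (held chunk p0031 L25)] -/
theorem det_lieMap (u : A ⟶ A) :
    LinearMap.det (lieMap A u) = LinearMap.det (cotangentMap A u) :=
  LinearMap.det_dualMap _

/-- **`tr Lie(u) = tr (u^* | 𝔪_e/𝔪_e²)`** (transpose; Mathlib `LinearMap.trace_transpose'`).
[cite: Shimura1998, §3.2] -/
theorem trace_lieMap (u : A ⟶ A) :
    LinearMap.trace K (Lie A) (lieMap A u) = LinearMap.trace K (Cotangent A) (cotangentMap A u) :=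
  LinearMap.trace_transpose' _

/-- **`charpoly Lie(u) = charpoly (u^* | 𝔪_e/𝔪_e²)`** (in dual bases the matrix of the transpose is
the transpose, Mathlib `LinearMap.toMatrix_transpose`, `Matrix.charpoly_transpose`). This is the
currency of «the characteristic polynomial of `i(e)` on `Lie_S(A)`» ([Liu2021] App. C, l. 4688)
over a field. [cite: Shimura1998, §3.2] -/
theorem charpoly_lieMap (u : A ⟶ A) :
    (lieMap A u).charpoly = (cotangentMap A u).charpoly := by
  classical
  let b := Module.Free.chooseBasis K (Cotangent A)
  rw [← LinearMap.charpoly_toMatrix (cotangentMap A u) b,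
    ← LinearMap.charpoly_toMatrix (lieMap A u) b.dualBasis, lieMap_eq_dualMap,
    LinearMap.dualMap_def, LinearMap.toMatrix_transpose, Matrix.charpoly_transpose]

variable (A) in
/-- **`det Lie([n]_A) = n^{dim A}`** (`Lie([n]) = n` on the `dim A`-dimensional `Lie(A)`;
Görtz–Wedhorn II, proof of Prop. 27.187 with Prop. 27.20).
[cite: GortzWedhorn2023, proof of Prop. 27.187 (p. 888) with Prop. 27.20 (p. 806)] -/
theorem det_lieMap_zsmul_id (n : ℤ) :
    LinearMap.det (lieMap A (n • 𝟙 A)) = (n : K) ^ A.dim := by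
  rw [det_lieMap, det_cotangentMap_zsmul_id]

/-! ### The action of the endomorphism algebra `End⁰(A) = ℚ ⊗ End(A)` on `Lie(A)` (`char K = 0`) -/

section RationalAction

variable [CharZero K]

variable (A) in
/-- **The action of `End⁰(A) = ℚ ⊗_ℤ End(A)` on the Lie algebra** (for `K` of characteristic `0`,
so that `Lie(A)` is a `ℚ`-vector space): the `ℚ`-algebra homomorphism
`End⁰(A) → End_K(Lie A)`, `q ⊗ u ↦ q · Lie(u)` extending the tangent representation
`lieMapRingHom` (Mathlib `Algebra.TensorProduct.lift`). This is the object «the action of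
`i_μ(x)`» for `i_μ : M_μ → End_E(A_μ)_ℚ` «on the `E`-vector space `Lie_E(A_μ)`» of [Liu2021]
Def. 4.5 (first bullet, l. 1950); Shimura §3.2 (the representation of `End(A) ⊗ ℚ` on the tangent
space). [cite: Liu2021, Def. 4.5 (2) first bullet (l. 1950)] -/
def lieAction : A.endAlgebra →ₐ[ℚ] Module.End K (Lie A) :=
  Algebra.TensorProduct.lift (Algebra.ofId ℚ (Module.End K (Lie A)))
    { lieMapRingHom A with
      commutes' := fun n ↦ RingHom.congr_fun (RingHom.ext_int
        ((lieMapRingHom A).comp (algebraMap ℤ (End A))) (algebraMap ℤ (Module.End K (Lie A)))) n }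
    fun q _ ↦ Algebra.commute_algebraMap_left q _

/-- **`(q ⊗ u)` acts as `q · Lie(u)`**: `lieAction A (q ⊗ u) = algebraMap ℚ _ q * Lie(u)`
(Mathlib `Algebra.TensorProduct.lift_tmul`). [cite: Liu2021, Def. 4.5 (2) first bullet (l. 1950)] -/
theorem lieAction_tmul (q : ℚ) (u : End A) :
    lieAction A (q ⊗ₜ[ℤ] u) = algebraMap ℚ (Module.End K (Lie A)) q * lieMap A u := by
  change Algebra.TensorProduct.lift _ _ _ (q ⊗ₜ[ℤ] u) = _
  rw [Algebra.TensorProduct.lift_tmul]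
  rfl

/-- **`1 ⊗ u` acts as `Lie(u)`**: the action of `End⁰(A)` extends the tangent representation of
`End(A)` along `endAlgebra.of : End A → End⁰(A)`. [cite: Liu2021, Def. 4.5 (2) first bullet (l. 1950)] -/
theorem lieAction_of (u : End A) : lieAction A (endAlgebra.of A u) = lieMap A u := by
  change lieAction A ((1 : ℚ) ⊗ₜ[ℤ] u) = _
  rw [lieAction_tmul, map_one, one_mul]

/-- Scalars `q ∈ ℚ ⊆ End⁰(A) = End_ℚ(A)` act as `q`: the action is a homomorphism of `ℚ`-algebras
(Shimura §3.2: the representation of `End(A)` «can be uniquely extended to a representation of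
`Hom_ℚ`»; [Liu2021] Def. 4.5: `i_μ : M_μ → End_E(A_μ)_ℚ`). [cite: Shimura1998, §3.2 (held chunk p0031)] -/
theorem lieAction_algebraMap (q : ℚ) :
    lieAction A (algebraMap ℚ A.endAlgebra q) = algebraMap ℚ (Module.End K (Lie A)) q :=
  AlgHom.commutes _ q

/-- The `ℚ`-scalar `q` of `End_K(Lie A)` is the `K`-scalar `q`: `algebraMap ℚ (End_K Lie A) q = (q : K) • 1`
(plumbing between Mathlib's `ℚ`- and `K`-structures). [folklore] -/
private theorem algebraMap_rat_moduleEnd_lie (q : ℚ) :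
    algebraMap ℚ (Module.End K (Lie A)) q = (q : K) • (1 : Module.End K (Lie A)) := by
  rw [Algebra.algebraMap_eq_smul_one, ← algebraMap_smul K q (1 : Module.End K (Lie A)), eq_ratCast]

/-- **`(q ⊗ u)` acts as the `K`-multiple `q · Lie(u)`**. [cite: Liu2021, Def. 4.5 (2) first bullet (l. 1950)] -/
theorem lieAction_tmul_eq_smul (q : ℚ) (u : End A) :
    lieAction A (q ⊗ₜ[ℤ] u) = (q : K) • lieMap A u := by
  rw [lieAction_tmul, algebraMap_rat_moduleEnd_lie, smul_mul_assoc, one_mul]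

/-- **The action of `M⁻¹ · (1 ⊗ f)` is `M⁻¹ · Lie(f)`** — every element of `End⁰(A)` has this form
(`endAlgebra.exists_eq_algebraMap_mul_of`). [cite: Liu2021, Def. 4.5 (2) first bullet (l. 1950)] -/
theorem lieAction_of_eq_algebraMap_mul_of {y : A.endAlgebra} {M : ℕ} {f : End A}
    (h : y = algebraMap ℚ A.endAlgebra (M : ℚ)⁻¹ * endAlgebra.of A f) :
    lieAction A y = ((M : K)⁻¹) • lieMap A f := by
  rw [h, map_mul, lieAction_algebraMap, lieAction_of, algebraMap_rat_moduleEnd_lie, smul_mul_assoc,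
    one_mul, Rat.cast_inv, Rat.cast_natCast]

/-- **`det (M⁻¹ · (1 ⊗ f) | Lie A) = M^{-dim A} · det (f^* | 𝔪_e/𝔪_e²)`**: the determinant of the
action of `y = M⁻¹ · (1 ⊗ f) ∈ End⁰(A)` on the `dim A`-dimensional Lie algebra, in terms of the
cotangent map of the genuine endomorphism `f` (`det (c • g) = c^{dim} det g`, `det Lie(f) = det f^*`).
[cite: Liu2021, Def. 4.5 (2) first bullet (l. 1950)] -/
theorem det_lieAction_of_eq_algebraMap_mul_of {y : A.endAlgebra} {M : ℕ} {f : End A}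
    (h : y = algebraMap ℚ A.endAlgebra (M : ℚ)⁻¹ * endAlgebra.of A f) :
    LinearMap.det (lieAction A y) = ((M : K) ^ A.dim)⁻¹ * LinearMap.det (cotangentMap A f) := by
  rw [lieAction_of_eq_algebraMap_mul_of h, LinearMap.det_smul, finrank_lie, det_lieMap, inv_pow]

/-- **The printed determinant condition ⟺ its cleared-denominator cotangent form.** For
`y = M⁻¹ · (1 ⊗ f) ∈ End⁰(A)` with `M ≠ 0` and any `c ∈ K`:
`det (y | Lie A) = c ↔ det (f^* | 𝔪_e/𝔪_e²) = M^{dim A} · c`. With `y = i_μ(x)` and `c = η_μ(x)`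
the left side is [Liu2021] Def. 4.5 (2), first bullet, VERBATIM («the determinant of the action of
`i_μ(x)` on the `E`-vector space `Lie_E(A_μ)` equals `η_μ(x)`») and the right side is the form in
which `Liu2021/Def45AsPrinted` records it. [cite: Liu2021, Def. 4.5 (2) first bullet (l. 1950)] -/
theorem det_lieAction_eq_iff {y : A.endAlgebra} {M : ℕ} {f : End A} (hM : M ≠ 0)
    (h : y = algebraMap ℚ A.endAlgebra (M : ℚ)⁻¹ * endAlgebra.of A f) (c : K) :
    LinearMap.det (lieAction A y) = c ↔
      LinearMap.det (cotangentMap A f) = (M : K) ^ A.dim * c := by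
  have hMK : ((M : K) ^ A.dim) ≠ 0 := pow_ne_zero _ (Nat.cast_ne_zero.mpr hM)
  rw [det_lieAction_of_eq_algebraMap_mul_of h, inv_mul_eq_iff_eq_mul₀ hMK]

/-- The same bridge with the determinant on the Lie algebra of the genuine endomorphism `f`:
`det (y | Lie A) = c ↔ det Lie(f) = M^{dim A} · c`. [cite: Liu2021, Def. 4.5 (2) first bullet (l. 1950)] -/
theorem det_lieAction_eq_iff_det_lieMap {y : A.endAlgebra} {M : ℕ} {f : End A} (hM : M ≠ 0)
    (h : y = algebraMap ℚ A.endAlgebra (M : ℚ)⁻¹ * endAlgebra.of A f) (c : K) :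
    LinearMap.det (lieAction A y) = c ↔ LinearMap.det (lieMap A f) = (M : K) ^ A.dim * c := by
  rw [det_lieAction_eq_iff hM h c, det_lieMap]

end RationalAction

end AbelianVariety

end Literature.AlgebraicGeometry.Motives
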